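import Mathlib

/-!
# The cyclic pencil `z·1 − X_w`: powers of a weighted cyclic shift, its determinant and adjugate

Crux `ValuativeGCT.ValuativeFlip` (stmt-ValiantsHypothesis-12624), wall-breaker axis D
("det-orbit-closure multiplicity bounds for detCensus", seat k3 gen 1), first file of the chain
that discharges row 3 of the few-row table UNCONDITIONALLY: every ternary form of degree `m` lies in
`Δ(det_m)` (the hypothesis `H(3)` of `noFlip_of_topForms_mem_orbitClosure`), via the Jacobian
criterion at ONE explicit determinantal representation.  This file is the linear algebra of that
representation.

For a commutative ring `R`, weights `w : Fin (n+1) → R` and a scalar `z : R` let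
`X_w = cshift⟦w⟧` be the weighted cyclic shift (`(X_w)_{i,i+1} = wᵢ`, zero elsewhere) and
`M₀ = z·1 − X_w`.  Then
* `X_w ^ k` has the single nonzero entry `(X_w^k)_{i,i+k} = wᵢ wᵢ₊₁ ⋯ wᵢ₊ₖ₋₁` (an ARC PRODUCT,
  `arc⟦w, i, k⟧`) in each row (`cyclicShift_pow`), and `X_w ^ (n+1) = (∏ wᵢ)·1`;
* `B = Σ_{k ≤ n} z^{n-k} X_w^k` (`cadj⟦n, z, w⟧`) satisfies `M₀ B = B M₀ = (z^{n+1} − ∏ wᵢ)·1`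
  (telescoping);
* `det M₀ = z^{n+1} − ∏ wᵢ` (Leibniz: only the identity and the rotation `i ↦ i − 1` survive);
* hence over a domain, when `z^{n+1} ≠ ∏ wᵢ`, `adj M₀ = B`, whose entries are
  `(adj M₀)_{i,i+k} = z^{n-k} · arc⟦w, i, k⟧` — single products of `z`'s and consecutive weights.
With `R = ℂ[x,y,z]`, `wᵢ = x − ηᵢ y` this is a determinantal representation of the smooth curve
`z^{m} = ∏ (x − ηᵢ y)` whose cofactors are explicit; the next files show that
`x_t · (cofactors)` span all ternary forms of degree `m` (the differential of
`(A₀,A₁,A₂) ↦ det(A₀x + A₁y + A₂z)` is onto at this point).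

References: L. E. Dickson, *Determination of all general homogeneous polynomials expressible as
determinants with linear elements*, Trans. AMS 22 (1921); A. Beauville, *Determinantal
hypersurfaces*, Michigan Math. J. 48 (2000) §2–4.  Everything here is elementary matrix algebra
[folklore].
-/

-- `Summit.ValiantsHypothesis.ValiantsHypothesis.…` is the tree's mandated single-conjunct layout (Sub = Summit).
set_option linter.dupNamespace false

namespace Summit.ValiantsHypothesis.ValiantsHypothesis.Theorems.ValuativeFlip

open scoped BigOperators Matrix
open Finset
open Fin.CommRing  -- `Fin (n+1)` as a commutative ring (scoped Mathlib instance): cyclic index arithmetic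

section CyclicShift

variable {R : Type*} [CommRing R] {n : ℕ}

/-- `cshift⟦w⟧`, the weighted cyclic shift `X_w`: `(X_w)_{i j} = wᵢ` if `j = i + 1 (mod n+1)`,
else `0` (a `local notation`, so that the files of this chain stay definition-free). -/
local notation3 (prettyPrint := false) "cshift⟦" w "⟧" =>
  (Matrix.of fun i j => if j = i + 1 then w i else 0)

/-- `arc⟦w, i, k⟧`, the ARC PRODUCT `wᵢ wᵢ₊₁ ⋯ wᵢ₊ₖ₋₁` of `k` cyclically consecutive weights
starting at `i`. -/
local notation3 (prettyPrint := false) "arc⟦" w ", " i ", " k "⟧" =>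
  (∏ s ∈ Finset.range k, w (i + Nat.cast s))

/-- `cadj⟦n, z, w⟧ = Σ_{k ≤ n} z^{n-k} X_w^k`, the candidate adjugate of `z·1 − X_w`. -/
local notation3 (prettyPrint := false) "cadj⟦" n ", " z ", " w "⟧" =>
  (∑ k ∈ Finset.range (n + 1), z ^ (n - k) • cshift⟦w⟧ ^ k)

/-- Unfolding the entries of `X_w`. [folklore] -/
theorem cyclicShift_apply (w : Fin (n + 1) → R) (i j : Fin (n + 1)) :
    (cshift⟦w⟧ : Matrix (Fin (n + 1)) (Fin (n + 1)) R) i j = if j = i + 1 then w i else 0 := rfl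

/-- `arc⟦w, i, 0⟧ = 1`. [folklore] -/
theorem arcProd_zero (w : Fin (n + 1) → R) (i : Fin (n + 1)) : (arc⟦w, i, 0⟧ : R) = 1 := by
  simp

/-- Peeling the last factor: `arc⟦w, i, k+1⟧ = arc⟦w, i, k⟧ * w (i + k)`. [folklore] -/
theorem arcProd_succ (w : Fin (n + 1) → R) (i : Fin (n + 1)) (k : ℕ) :
    (arc⟦w, i, k + 1⟧ : R) = arc⟦w, i, k⟧ * w (i + (k : Fin (n + 1))) := by
  rw [prod_range_succ]

/-- Peeling the first factor: `arc⟦w, i, k+1⟧ = w i * arc⟦w, i + 1, k⟧`. [folklore] -/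
theorem arcProd_succ' (w : Fin (n + 1) → R) (i : Fin (n + 1)) (k : ℕ) :
    (arc⟦w, i, k + 1⟧ : R) = w i * arc⟦w, i + 1, k⟧ := by
  rw [prod_range_succ']
  simp only [Nat.cast_zero, add_zero, Nat.cast_succ]
  rw [mul_comm]
  congr 1
  refine prod_congr rfl fun s _ => ?_
  congr 1
  ring

/-- The full arc is the product of all weights: `arc⟦w, i, n+1⟧ = ∏ wⱼ`. [folklore] -/
theorem arcProd_card (w : Fin (n + 1) → R) (i : Fin (n + 1)) :
    (arc⟦w, i, n + 1⟧ : R) = ∏ j, w j := by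
  rw [prod_range (fun s => w (i + (s : Fin (n + 1))))]
  simp only [Fin.cast_val_eq_self]
  exact Fintype.prod_equiv (Equiv.addLeft i) _ _ fun s => rfl

/-- **Powers of the weighted cyclic shift**: `(X_w^k)_{i j} = [j = i + k] · arcProd w i k`.
[folklore] -/
theorem cyclicShift_pow (w : Fin (n + 1) → R) (k : ℕ) :
    (cshift⟦w⟧ : Matrix (Fin (n + 1)) (Fin (n + 1)) R) ^ k =
      Matrix.of fun i j => if j = i + (k : Fin (n + 1)) then arc⟦w, i, k⟧ else 0 := by
  induction k with
  | zero =>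
    ext i j
    simp only [pow_zero, Matrix.one_apply, Matrix.of_apply, Nat.cast_zero, add_zero, arcProd_zero]
    by_cases h : i = j
    · simp [h]
    · simp [h, Ne.symm h]
  | succ k ih =>
    ext i j
    rw [pow_succ, ih, Matrix.mul_apply]
    simp only [Matrix.of_apply, ite_mul, zero_mul, Finset.sum_ite_eq', Finset.mem_univ, if_true]
    rw [mul_ite, mul_zero, arcProd_succ, Nat.cast_succ, ← add_assoc]

/-- `X_w^{n+1} = (∏ wⱼ) · 1`. [folklore] -/
theorem cyclicShift_pow_card (w : Fin (n + 1) → R) :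
    (cshift⟦w⟧ : Matrix (Fin (n + 1)) (Fin (n + 1)) R) ^ (n + 1) =
      (∏ j, w j) • (1 : Matrix (Fin (n + 1)) (Fin (n + 1)) R) := by
  rw [cyclicShift_pow]
  ext i j
  have h0 : ((n + 1 : ℕ) : Fin (n + 1)) = 0 := by simp
  simp only [Matrix.of_apply, h0, add_zero, arcProd_card, Matrix.smul_apply, Matrix.one_apply,
    smul_eq_mul, mul_ite, mul_one, mul_zero]
  by_cases h : j = i
  · simp [h]
  · simp [h, Ne.symm h]

/-- `(z·1 − X_w) · B = (z^{n+1} − ∏ wⱼ) · 1` (telescoping sum). [folklore] -/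
theorem smul_one_sub_cyclicShift_mul_cyclicAdj (z : R) (w : Fin (n + 1) → R) :
    (z • (1 : Matrix (Fin (n + 1)) (Fin (n + 1)) R) - cshift⟦w⟧) * cadj⟦n, z, w⟧ =
      (z ^ (n + 1) - ∏ j, w j) • (1 : Matrix (Fin (n + 1)) (Fin (n + 1)) R) := by
  set X : Matrix (Fin (n + 1)) (Fin (n + 1)) R := cshift⟦w⟧ with hX
  set f : ℕ → Matrix (Fin (n + 1)) (Fin (n + 1)) R := fun k => z ^ (n + 1 - k) • X ^ k with hf
  have h1 : (z • (1 : Matrix (Fin (n + 1)) (Fin (n + 1)) R)) * cadj⟦n, z, w⟧ =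
      ∑ k ∈ range (n + 1), f k := by
    rw [Matrix.smul_mul, Matrix.one_mul, smul_sum]
    refine sum_congr rfl fun k hk => ?_
    rw [smul_smul, hf, ← pow_succ']
    congr 2
    have := mem_range.mp hk
    omega
  have h2 : X * cadj⟦n, z, w⟧ = ∑ k ∈ range (n + 1), f (k + 1) := by
    rw [Matrix.mul_sum]
    refine sum_congr rfl fun k hk => ?_
    rw [Matrix.mul_smul, hf, ← pow_succ']
    congr 2
    omega
  rw [sub_mul, h1, h2, ← sum_sub_distrib, sum_range_sub', hf]
  simp only [Nat.sub_zero, pow_zero, one_smul, Nat.sub_self, hX, cyclicShift_pow_card, sub_smul]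

/-- `B · (z·1 − X_w) = (z^{n+1} − ∏ wⱼ) · 1` (telescoping sum). [folklore] -/
theorem cyclicAdj_mul_smul_one_sub_cyclicShift (z : R) (w : Fin (n + 1) → R) :
    cadj⟦n, z, w⟧ * (z • (1 : Matrix (Fin (n + 1)) (Fin (n + 1)) R) - cshift⟦w⟧) =
      (z ^ (n + 1) - ∏ j, w j) • (1 : Matrix (Fin (n + 1)) (Fin (n + 1)) R) := by
  set X : Matrix (Fin (n + 1)) (Fin (n + 1)) R := cshift⟦w⟧ with hX
  set f : ℕ → Matrix (Fin (n + 1)) (Fin (n + 1)) R := fun k => z ^ (n + 1 - k) • X ^ k with hf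
  have h1 : cadj⟦n, z, w⟧ * (z • (1 : Matrix (Fin (n + 1)) (Fin (n + 1)) R)) =
      ∑ k ∈ range (n + 1), f k := by
    rw [Matrix.mul_smul, Matrix.mul_one, smul_sum]
    refine sum_congr rfl fun k hk => ?_
    rw [smul_smul, hf, ← pow_succ']
    congr 2
    have := mem_range.mp hk
    omega
  have h2 : cadj⟦n, z, w⟧ * X = ∑ k ∈ range (n + 1), f (k + 1) := by
    rw [Matrix.sum_mul]
    refine sum_congr rfl fun k hk => ?_
    rw [Matrix.smul_mul, hf, ← pow_succ]
    congr 2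
    omega
  rw [mul_sub, h1, h2, ← sum_sub_distrib, sum_range_sub', hf]
  simp only [Nat.sub_zero, pow_zero, one_smul, Nat.sub_self, hX, cyclicShift_pow_card, sub_smul]


/-- Entries of `M₀ = z·1 − X_w`. [folklore] -/
theorem smul_one_sub_cyclicShift_apply (z : R) (w : Fin (n + 1) → R) (l c : Fin (n + 1)) :
    (z • (1 : Matrix (Fin (n + 1)) (Fin (n + 1)) R) - cshift⟦w⟧ : Matrix (Fin (n + 1)) (Fin (n + 1)) R) l c =
      (if l = c then z else 0) - (if c = l + 1 then w l else 0) := by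
  simp [Matrix.one_apply]

/-- A permutation of `Fin (n+1)`, `n ≥ 1`, moving every point to itself or to its predecessor is
the identity or the rotation `i ↦ i − 1` (a nonempty proper set of "moved" points would have to be
closed under predecessor, by injectivity). [folklore] -/
theorem perm_eq_one_or_eq_finRotate_symm (hn : 1 ≤ n) (π : Equiv.Perm (Fin (n + 1)))
    (h : ∀ i, π i = i ∨ π i = i - 1) : π = 1 ∨ π = (finRotate (n + 1)).symm := by
  by_cases hall : ∀ i, π i = i
  · left
    ext i
    simp [hall i]
  · right
    push Not at hall
    obtain ⟨i₀, hi₀⟩ := hall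
    have h0 : π i₀ = i₀ - 1 := (h i₀).resolve_left hi₀
    have h10 : (1 : Fin (n + 1)) ≠ 0 := by
      rw [Ne, Fin.one_eq_zero_iff]
      omega
    have key : ∀ k : ℕ, π (i₀ - (k : Fin (n + 1))) = i₀ - (k : Fin (n + 1)) - 1 := by
      intro k
      induction k with
      | zero => simpa using h0
      | succ k ih =>
        have hl : i₀ - ((k + 1 : ℕ) : Fin (n + 1)) = i₀ - (k : Fin (n + 1)) - 1 := by
          push_cast
          ring
        rw [hl]
        rcases h (i₀ - (k : Fin (n + 1)) - 1) with h1 | h1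
        · exfalso
          rw [← ih] at h1
          have h2 := π.injective h1
          rw [ih] at h2
          exact h10 (sub_eq_self.mp h2)
        · exact h1
    have hρ : ∀ i, (finRotate (n + 1)).symm i = i - 1 := fun i => by
      rw [Equiv.symm_apply_eq, finRotate_apply]
      ring
    ext i
    have hi : i = i₀ - (((i₀ - i : Fin (n + 1)) : ℕ) : Fin (n + 1)) := by
      rw [Fin.cast_val_eq_self]
      ring
    rw [hρ, hi, key]

/-- **Determinant of the cyclic pencil**: `det (z·1 − X_w) = z^{n+1} − ∏ wⱼ` (in the Leibniz
expansion only the identity and the rotation `i ↦ i − 1` survive). [folklore] -/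
theorem det_smul_one_sub_cyclicShift (z : R) (w : Fin (n + 1) → R) :
    (z • (1 : Matrix (Fin (n + 1)) (Fin (n + 1)) R) - cshift⟦w⟧).det = z ^ (n + 1) - ∏ j, w j := by
  rcases Nat.eq_zero_or_pos n with rfl | hn
  · rw [Matrix.det_fin_one, smul_one_sub_cyclicShift_apply]
    have h01 : (0 : Fin (0 + 1)) = 0 + 1 := by decide
    rw [if_pos rfl, if_pos h01, Fin.prod_univ_succ, Fin.prod_univ_zero, mul_one, pow_one]
  set N : Matrix (Fin (n + 1)) (Fin (n + 1)) R :=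
    z • (1 : Matrix (Fin (n + 1)) (Fin (n + 1)) R) - cshift⟦w⟧ with hN
  have h10 : (1 : Fin (n + 1)) ≠ 0 := by
    rw [Ne, Fin.one_eq_zero_iff]
    omega
  have hρ : ∀ i, (finRotate (n + 1)).symm i = i - 1 := fun i => by
    rw [Equiv.symm_apply_eq, finRotate_apply]
    ring
  have hne : (1 : Equiv.Perm (Fin (n + 1))) ≠ (finRotate (n + 1)).symm := by
    intro heq
    have := congrArg (fun π : Equiv.Perm (Fin (n + 1)) => π 0) heq
    simp only [Equiv.Perm.one_apply, hρ, zero_sub] at this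
    exact h10 (neg_eq_zero.mp this.symm)
  have hzero : ∀ π : Equiv.Perm (Fin (n + 1)), π ≠ 1 ∧ π ≠ (finRotate (n + 1)).symm →
      Equiv.Perm.sign π • ∏ i, N (π i) i = 0 := by
    rintro π ⟨hπ1, hπρ⟩
    have hex : ∃ i, ¬ (π i = i ∨ π i = i - 1) := by
      by_contra hno
      push Not at hno
      rcases perm_eq_one_or_eq_finRotate_symm hn π hno with h | h
      · exact hπ1 h
      · exact hπρ h
    obtain ⟨i, hi⟩ := hex
    push Not at hi
    have hNi : N (π i) i = 0 := by
      rw [hN, smul_one_sub_cyclicShift_apply, if_neg hi.1, if_neg, sub_zero]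
      intro h
      exact hi.2 (eq_sub_iff_add_eq.mpr h.symm)
    rw [prod_eq_zero (f := fun j => N (π j) j) (mem_univ i) hNi, smul_zero]
  rw [Matrix.det_apply, Fintype.sum_eq_add (1 : Equiv.Perm (Fin (n + 1))) (finRotate (n + 1)).symm hne hzero]
  -- the identity term
  have h1 : Equiv.Perm.sign (1 : Equiv.Perm (Fin (n + 1))) •
      ∏ i, N ((1 : Equiv.Perm (Fin (n + 1))) i) i = z ^ (n + 1) := by
    rw [Equiv.Perm.sign_one, one_smul]
    simp only [Equiv.Perm.one_apply, hN, smul_one_sub_cyclicShift_apply, if_true]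
    have h : ∀ i : Fin (n + 1), ¬ (i = i + 1) := fun i h => h10 (left_eq_add.mp h)
    simp only [h, if_false, sub_zero, prod_const, card_univ, Fintype.card_fin]
  -- the rotation term
  have h2 : Equiv.Perm.sign (finRotate (n + 1)).symm • ∏ i, N ((finRotate (n + 1)).symm i) i =
      - ∏ j, w j := by
    rw [Equiv.Perm.sign_symm, sign_finRotate, Nat.add_sub_cancel]
    simp only [hρ, hN, smul_one_sub_cyclicShift_apply, sub_add_cancel, if_true]
    have h : ∀ i : Fin (n + 1), ¬ (i - 1 = i) := fun i h => h10 (sub_eq_self.mp h)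
    simp only [h, if_false, zero_sub]
    rw [prod_neg, card_univ, Fintype.card_fin,
      Fintype.prod_equiv (Equiv.subRight (1 : Fin (n + 1))) (fun i => w (i - 1)) w fun _ => rfl,
      Units.smul_def, Units.val_pow_eq_pow_val, Units.val_neg, Units.val_one, zsmul_eq_mul,
      Int.cast_pow, Int.cast_neg, Int.cast_one, ← mul_assoc, ← pow_add,
      show n + (n + 1) = 2 * n + 1 by ring, pow_succ, pow_mul, neg_one_sq, one_pow, one_mul, neg_one_mul]
  rw [h1, h2, sub_eq_add_neg]

/-- **Adjugate of the cyclic pencil**: over a domain, when `z^{n+1} ≠ ∏ wⱼ`,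
`adj (z·1 − X_w) = Σ_{k ≤ n} z^{n-k} X_w^k`. [folklore] -/
theorem adjugate_smul_one_sub_cyclicShift [IsDomain R] (z : R) (w : Fin (n + 1) → R)
    (hq : z ^ (n + 1) - ∏ j, w j ≠ 0) :
    (z • (1 : Matrix (Fin (n + 1)) (Fin (n + 1)) R) - cshift⟦w⟧).adjugate = cadj⟦n, z, w⟧ := by
  set N : Matrix (Fin (n + 1)) (Fin (n + 1)) R :=
    z • (1 : Matrix (Fin (n + 1)) (Fin (n + 1)) R) - cshift⟦w⟧ with hN
  set B : Matrix (Fin (n + 1)) (Fin (n + 1)) R := cadj⟦n, z, w⟧ with hB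
  set q := z ^ (n + 1) - ∏ j, w j with hq'
  have h1 : N * N.adjugate = q • (1 : Matrix (Fin (n + 1)) (Fin (n + 1)) R) := by
    rw [Matrix.mul_adjugate, hN, det_smul_one_sub_cyclicShift]
  have h2 : N * B = q • (1 : Matrix (Fin (n + 1)) (Fin (n + 1)) R) :=
    smul_one_sub_cyclicShift_mul_cyclicAdj z w
  have h3 : B * N = q • (1 : Matrix (Fin (n + 1)) (Fin (n + 1)) R) :=
    cyclicAdj_mul_smul_one_sub_cyclicShift z w
  have h : q • (N.adjugate - B) = 0 := by
    calc q • (N.adjugate - B)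
        = (B * N) * (N.adjugate - B) := by
          rw [h3, Matrix.smul_mul, Matrix.one_mul]
      _ = B * (N * N.adjugate - N * B) := by
          rw [Matrix.mul_assoc, Matrix.mul_sub]
      _ = 0 := by rw [h1, h2, sub_self, Matrix.mul_zero]
  exact sub_eq_zero.mp ((smul_eq_zero.mp h).resolve_left hq)

/-- Casting `k < n + 1` into `Fin (n+1)` is injective. [folklore] -/
theorem natCast_fin_injOn {k k' : ℕ} (hk : k < n + 1) (hk' : k' < n + 1)
    (h : (k : Fin (n + 1)) = (k' : Fin (n + 1))) : k = k' := by
  have := congrArg Fin.val h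
  rwa [Fin.val_natCast, Fin.val_natCast, Nat.mod_eq_of_lt hk, Nat.mod_eq_of_lt hk'] at this

/-- **Entries of the adjugate candidate**: `B_{i j} = z^{n-k} · arcProd w i k` with `k = (j − i) mod (n+1)`
— a single term of the sum survives. [folklore] -/
theorem cyclicAdj_apply (z : R) (w : Fin (n + 1) → R) (i j : Fin (n + 1)) :
    (cadj⟦n, z, w⟧ : Matrix (Fin (n + 1)) (Fin (n + 1)) R) i j =
      z ^ (n - ((j - i : Fin (n + 1)) : ℕ)) * arc⟦w, i, ((j - i : Fin (n + 1)) : ℕ)⟧ := by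
  rw [Matrix.sum_apply]
  simp only [Matrix.smul_apply, cyclicShift_pow, Matrix.of_apply, smul_eq_mul, mul_ite, mul_zero]
  rw [sum_eq_single ((j - i : Fin (n + 1)) : ℕ)]
  · rw [if_pos]
    rw [Fin.cast_val_eq_self]
    ring
  · intro k hk hne
    rw [if_neg]
    intro hji
    apply hne
    refine natCast_fin_injOn (mem_range.mp hk) (Fin.is_lt _) ?_
    rw [Fin.cast_val_eq_self, hji]
    ring
  · intro h
    exact absurd (mem_range.mpr (Fin.is_lt _)) h

/-- The same entries along an arc: `B_{i, i+k} = z^{n-k} · arcProd w i k` for `k ≤ n`. [folklore] -/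
theorem cyclicAdj_apply_add (z : R) (w : Fin (n + 1) → R) (i : Fin (n + 1)) {k : ℕ}
    (hk : k < n + 1) :
    (cadj⟦n, z, w⟧ : Matrix (Fin (n + 1)) (Fin (n + 1)) R) i (i + (k : Fin (n + 1))) =
      z ^ (n - k) * arc⟦w, i, k⟧ := by
  rw [cyclicAdj_apply]
  have : (((i + (k : Fin (n + 1)) - i : Fin (n + 1))) : ℕ) = k := by
    rw [add_sub_cancel_left, Fin.val_natCast, Nat.mod_eq_of_lt hk]
  rw [this]

/-- **Cofactors of the cyclic pencil** (summary): over a domain with `z^{n+1} ≠ ∏ wⱼ`, the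
adjugate of `z·1 − X_w` has entries `(adj)_{i, i+k} = z^{n-k} · wᵢ wᵢ₊₁ ⋯ wᵢ₊ₖ₋₁` (`k ≤ n`).
[folklore] -/
theorem adjugate_smul_one_sub_cyclicShift_apply_add [IsDomain R] (z : R) (w : Fin (n + 1) → R)
    (hq : z ^ (n + 1) - ∏ j, w j ≠ 0) (i : Fin (n + 1)) {k : ℕ} (hk : k < n + 1) :
    (z • (1 : Matrix (Fin (n + 1)) (Fin (n + 1)) R) - cshift⟦w⟧).adjugate i (i + (k : Fin (n + 1))) =
      z ^ (n - k) * arc⟦w, i, k⟧ := by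
  rw [adjugate_smul_one_sub_cyclicShift z w hq, cyclicAdj_apply_add z w i hk]

end CyclicShift

/-- **Cofactors of the cyclic pencil, notation-free form** (the registered helper of this file):
over a domain with `z^{n+1} ≠ ∏ wⱼ`, the adjugate of `z·1 − X_w` (`X_w` the weighted cyclic shift,
`(X_w)_{i,i+1} = wᵢ`) has entries `(adj)_{i, i+k} = z^{n-k} · wᵢ wᵢ₊₁ ⋯ wᵢ₊ₖ₋₁` for `k ≤ n`.
[folklore] -/
theorem cyclicPencil_adjugate_apply_add {R : Type*} [CommRing R] [IsDomain R] {n : ℕ} (z : R)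
    (w : Fin (n + 1) → R) (hq : z ^ (n + 1) - ∏ j, w j ≠ 0) (i : Fin (n + 1)) {k : ℕ}
    (hk : k < n + 1) :
    (z • (1 : Matrix (Fin (n + 1)) (Fin (n + 1)) R) -
        Matrix.of fun i j : Fin (n + 1) => if j = i + 1 then w i else 0).adjugate i
        (i + (k : Fin (n + 1))) =
      z ^ (n - k) * ∏ s ∈ Finset.range k, w (i + (s : Fin (n + 1))) :=
  adjugate_smul_one_sub_cyclicShift_apply_add z w hq i hk


end Summit.ValiantsHypothesis.ValiantsHypothesis.Theorems.ValuativeFlip
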